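import Literature.MathematicalPhysics.QuantumFieldTheory.Balaban1983to89.B9Thm311AdjointPairs

/-!
# `Balaban1983to89.B9Thm311Curv2Symm` — the COMMUTATOR PART `Δ′₂(U)` of the Hessian (3.10) IS SYMMETRIC for the trace pairing at unitary-valued
# configurations (the last algebraic input of «Δ_a(U), G(U) symmetric» at def-Y's letters, `B9Thm311AdjointPairs.GAY_isSymmTr_of`)

T. Bałaban, *Propagators for lattice gauge theories in a background field*, Commun. Math. Phys. **99** (1985) 389–434
[`Balaban1985BackgroundPropagators`, "B9"].

statement-level skeleton of published theorems with citation tags; proofs where landed; nothing here is a claim about the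
Yang–Mills mass gap

THE PRINTED LOCUS (verbatim, p. 392, (3.10)): *"For U with values in the unitary group U(N) it is a hermitian operator given by the quadratic form
⟨A, ΔA⟩ = ⟨A, D\*DA⟩ + ⟨A, Δ′A⟩, ⟨A, Δ′A⟩ = Σ_p η^d tr((D¹_U A)(p))² η⁻²(Re U(∂p) − 1) + tr Σ_{b₁,b₂⊂∂(p)_z, b₁≺b₂} i[A′(b₁), A′(b₂)]η⁻² Im U(∂p)."*

WHY THIS FILE.  def-Y's `curv2Y U` (`OpsYDeltaA`) is the operator of the polarised second term of (3.10) for the bilinear trace pairing; print asserts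
that Δ is *"a hermitian operator"* for unitary U.  THIS FILE proves the corresponding statement for `curv2Y`: `IsSymmTr 1 (curv2Y i U)` at every
unitary-valued configuration — the mechanism: the commutator insertion `X ↦ i[X, M]` with `M = c_f²·Im U(∂p)` HERMITIAN is ANTI-symmetric for the
trace pairing and commutes with conjugation, and the contour sign `ε(l, m) = [m ≺ l] − [l ≺ m]` is antisymmetric; the two signs cancel.  With it,
`B9Thm311AdjointPairs.deltaAY_isSymmTr_of ∕ GAY_isSymmTr_of` lose their `curv2Y` hypothesis: def-Y's Δ_a(U) and G(U) ARE symmetric at `G`-valued data given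
a symmetric Δ′_a(U) (v4) and the `W`-adjointness of Q′\* (a theorem) — no invertibility needed (`Ring.inverse` keeps symmetry).

* §1 `commY_apply`, `conjTranspose_commY`, `trace_commY_mul`, `trace_conjTranspose_commY_mul`.
* §2 `contourSum`, `curv2Y_apply`, `primeEdgeY_apply`, `star_sgnY`, `eps` (`eps_swap`, `star_eps`), `contourSum_apply`, `conjTranspose_imHolY`, `conjTranspose_weight`,
  `tau` (`tau_swap`), `edgeParY_mem_unitary`, `curv2Y_term`, ★ `sum_trace_curv2Y`, ★★ `curv2Y_isSymmTr`.
* §3 ★★ `deltaAY_isSymmTr`, ★★ `GAY_isSymmTr`.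

HONEST SCOPE.  Finite-dimensional algebra; NOT a node discharge, NOT summit progress; count-neutral; nothing continuum, nothing about the mass gap.
Cell `pub-ymgap` (HUMAN RULING D-0062), Track A node N06 [B9], seat `pub-ymgap-dag-n06-j` (harness re-seat gen 6), 2026-08-27.
-/

namespace Literature.MathematicalPhysics.QuantumFieldTheory.Balaban1983to89.B9Thm311Curv2Symm

open Literature.MathematicalPhysics.QuantumFieldTheory.Balaban1983to89
open B9Thm311ReadingCoords B9Thm311AdjointAtLetters B9Thm311DeltaPrimeSymm B9Thm311AdjointPairs B9Ineq349SiteAdjoint Node00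
open B6KLevelCensusIndexV1 B9PinMembersKLevelV1 B7Prop2SpecialUnitary
open scoped Matrix

noncomputable section

/-! ## §1 The commutator insertion `X ↦ i[X, M]` with `M` Hermitian: conjugation and the trace pairing -/

section Comm

open scoped Matrix.Norms.L2Operator

variable {N : ℕ}

/-- `commY M X = i(XM − MX)`, evaluated. [cite: Balaban1985BackgroundPropagators, (3.10) p.392, bookkeeping] -/
theorem commY_apply (M X : Matrix (Fin N) (Fin N) ℂ) : commY M X = Complex.I • (X * M - M * X) := rfl

/-- conjugation through the commutator insertion with a HERMITIAN `M`: `(i[X, M])\* = i[X\*, M]`. [cite: Balaban1985BackgroundPropagators, (3.10) p.392 (hermitian)] -/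
theorem conjTranspose_commY {M : Matrix (Fin N) (Fin N) ℂ} (hM : Mᴴ = M) (X : Matrix (Fin N) (Fin N) ℂ) :
    (commY M X)ᴴ = commY M Xᴴ := by
  rw [commY_apply, commY_apply, Matrix.conjTranspose_smul, Matrix.conjTranspose_sub, Matrix.conjTranspose_mul, Matrix.conjTranspose_mul, hM,
    Complex.star_def, Complex.conj_I, neg_smul, ← smul_neg, neg_sub]

/-- the commutator insertion is ANTI-symmetric for the bilinear trace pairing: `tr(i[X, M]·Y) = −tr(X·i[Y, M])`. [cite: Balaban1985BackgroundPropagators, (3.10) p.392, bookkeeping] -/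
theorem trace_commY_mul (M X Y : Matrix (Fin N) (Fin N) ℂ) : Matrix.trace (commY M X * Y) = -Matrix.trace (X * commY M Y) := by
  rw [commY_apply, commY_apply, Matrix.smul_mul, Matrix.mul_smul, Matrix.trace_smul, Matrix.trace_smul, ← smul_neg, Matrix.sub_mul, Matrix.mul_sub,
    Matrix.trace_sub, Matrix.trace_sub, neg_sub, Matrix.mul_assoc, Matrix.mul_assoc, Matrix.trace_mul_comm M (X * Y), Matrix.mul_assoc]

/-- the sesquilinear version: `tr((i[X, M])\*·Y) = −tr(X\*·i[Y, M])` for Hermitian `M`. [cite: Balaban1985BackgroundPropagators, (3.10) p.392, bookkeeping] -/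
theorem trace_conjTranspose_commY_mul {M : Matrix (Fin N) (Fin N) ℂ} (hM : Mᴴ = M) (X Y : Matrix (Fin N) (Fin N) ℂ) :
    Matrix.trace ((commY M X)ᴴ * Y) = -Matrix.trace (Xᴴ * commY M Y) := by
  rw [conjTranspose_commY hM, trace_commY_mul]

end Comm

/-! ## §2 `Δ′₂(U)` evaluated, and its trace pairing as an antisymmetric double contour sum -/

section Pairing

open scoped Matrix.Norms.L2Operator

variable {d ℓ : ℕ} {hd : 1 ≤ d + 1} {hL : Odd (ℓ + 1) ∧ 1 < ℓ + 1} {b₀ b₁ : ℝ} {N : ℕ}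
variable (i : KIdx d ℓ hd hL b₀ b₁) (U : CfgY (Matrix (Fin N) (Fin N) ℂ) i)

/-- the signed contour sum `S_m(A) = Σ_{l ≻ m} A′(b_l) − Σ_{l ≺ m} A′(b_l)` of the primed variables at a plaquette. [cite: Balaban1985BackgroundPropagators, (3.2) p.390, (3.10) p.392, dictionary] -/
def contourSum (p : PlaqY i) (m : Fin 4) : (FBondY i → Matrix (Fin N) (Fin N) ℂ) →ₗ[ℂ] Matrix (Fin N) (Fin N) ℂ :=
  (∑ l : Fin 4, if m < l then primeEdgeY i U p l else 0) - ∑ l : Fin 4, if l < m then primeEdgeY i U p l else 0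

/-- `Δ′₂(U)`, evaluated at a bond. [cite: Balaban1985BackgroundPropagators, (3.10) p.392, bookkeeping] -/
theorem curv2Y_apply (A : FBondY i → Matrix (Fin N) (Fin N) ℂ) (b : FBondY i) :
    curv2Y i U A b = (1 / 2 : ℂ) • ∑ p : PlaqY i, ∑ m : Fin 4,
      if edgeY i p m = b then sgnY m • B9Eq39Adjoint.R (edgeParY i U p m)⁻¹
        (commY ((((i.cf ^ 2 : ℝ)) : ℂ) • imHolY i U p) (contourSum i U p m A)) else 0 := by
  unfold curv2Y contourSum
  simp only [LinearMap.smul_apply, Pi.smul_apply, LinearMap.pi_apply, LinearMap.coe_sum, Finset.sum_apply]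
  congr 1
  refine Finset.sum_congr rfl fun p _ => Finset.sum_congr rfl fun m _ => ?_
  split_ifs with h
  · rfl
  · rfl

/-- the primed contour variable, evaluated: `A′(b_m) = σ_m • R(V_m) A(b_m)`. [cite: Balaban1985BackgroundPropagators, (3.2) p.390, bookkeeping] -/
theorem primeEdgeY_apply (p : PlaqY i) (m : Fin 4) (A : FBondY i → Matrix (Fin N) (Fin N) ℂ) :
    primeEdgeY i U p m A = sgnY m • B9Eq39Adjoint.R (edgeParY i U p m) (A (edgeY i p m)) := rfl

/-- the contour signs are real: `σ̄_m = σ_m`. [cite: Balaban1985BackgroundPropagators, (3.5) p.391, bookkeeping] -/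
theorem star_sgnY (m : Fin 4) : star (sgnY m) = sgnY m := by
  fin_cases m <;> simp [sgnY]

/-- the antisymmetric ordering sign `ε(l, m) = [m ≺ l] − [l ≺ m]` of the polarised commutator form. [cite: Balaban1985BackgroundPropagators, (3.10) p.392 (b₁ ≺ b₂), dictionary] -/
def eps (l m : Fin 4) : ℂ := (if m < l then 1 else 0) - (if l < m then 1 else 0)

/-- `ε` is antisymmetric. [cite: Balaban1985BackgroundPropagators, (3.10) p.392, bookkeeping] -/
theorem eps_swap (l m : Fin 4) : eps m l = -eps l m := by
  unfold eps; ring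

/-- `ε` is real. [cite: Balaban1985BackgroundPropagators, (3.10) p.392, bookkeeping] -/
theorem star_eps (l m : Fin 4) : star (eps l m) = eps l m := by
  unfold eps; split_ifs <;> simp

/-- the signed contour sum is `Σ_l ε(l, m) • A′(b_l)`. [cite: Balaban1985BackgroundPropagators, (3.10) p.392, bookkeeping] -/
theorem contourSum_apply (p : PlaqY i) (m : Fin 4) (A : FBondY i → Matrix (Fin N) (Fin N) ℂ) :
    contourSum i U p m A = ∑ l : Fin 4, eps l m • primeEdgeY i U p l A := by
  unfold contourSum eps
  simp only [LinearMap.sub_apply, LinearMap.coe_sum, Finset.sum_apply, sub_smul, Finset.sum_sub_distrib, ite_smul, one_smul, zero_smul]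
  congr 1 <;> refine Finset.sum_congr rfl fun l _ => ?_ <;> split_ifs <;> simp

/-- `Im U(∂p)` is Hermitian at a unitary-valued configuration. [cite: Balaban1985BackgroundPropagators, (3.7) p.391, bookkeeping] -/
theorem conjTranspose_imHolY (hU : ∀ μ x, ((U μ x : (Matrix (Fin N) (Fin N) ℂ)ˣ) : Matrix (Fin N) (Fin N) ℂ) ∈ unitary (Matrix (Fin N) (Fin N) ℂ))
    (p : PlaqY i) : (imHolY i U p)ᴴ = imHolY i U p := by
  have hV := holY_mem_unitary i U hU p
  have h1 : (((holY i U p)⁻¹ : (Matrix (Fin N) (Fin N) ℂ)ˣ) : Matrix (Fin N) (Fin N) ℂ) = ((holY i U p : (Matrix (Fin N) (Fin N) ℂ)ˣ) : Matrix _ _ ℂ)ᴴ :=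
    val_inv_eq_conjTranspose _ hV
  unfold imHolY
  rw [h1, Matrix.conjTranspose_smul, Matrix.conjTranspose_sub, Matrix.conjTranspose_conjTranspose, ← neg_sub, smul_neg, ← neg_smul]
  congr 1
  rw [Complex.star_def, map_div₀, map_neg, Complex.conj_I, map_ofNat, neg_neg, neg_div]

/-- the (3.10) weight `M_p = c_f²·Im U(∂p)` is Hermitian at a unitary-valued configuration. [cite: Balaban1985BackgroundPropagators, (3.10) p.392, bookkeeping] -/
theorem conjTranspose_weight (hU : ∀ μ x, ((U μ x : (Matrix (Fin N) (Fin N) ℂ)ˣ) : Matrix (Fin N) (Fin N) ℂ) ∈ unitary (Matrix (Fin N) (Fin N) ℂ))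
    (p : PlaqY i) : (((((i.cf ^ 2 : ℝ)) : ℂ) • imHolY i U p))ᴴ = (((i.cf ^ 2 : ℝ)) : ℂ) • imHolY i U p := by
  rw [Matrix.conjTranspose_smul, conjTranspose_imHolY i U hU p, Complex.star_def, Complex.conj_ofReal]

/-- the pairing kernel of the polarised commutator form: `τ_p(A, B; l, m) = tr(A′(b_l)\* · i[B′(b_m), M_p])`. [cite: Balaban1985BackgroundPropagators, (3.10) p.392, dictionary] -/
def tau (p : PlaqY i) (A B : FBondY i → Matrix (Fin N) (Fin N) ℂ) (l m : Fin 4) : ℂ :=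
  Matrix.trace ((primeEdgeY i U p l A)ᴴ * commY ((((i.cf ^ 2 : ℝ)) : ℂ) • imHolY i U p) (primeEdgeY i U p m B))

/-- the kernel is conjugate-antisymmetric under `(A, l) ↔ (B, m)`: `τ_p(B, A; l, m) = −conj τ_p(A, B; m, l)` (the commutator insertion is anti-symmetric and
commutes with conjugation). [cite: Balaban1985BackgroundPropagators, (3.10) p.392, bookkeeping] -/
theorem tau_swap (hU : ∀ μ x, ((U μ x : (Matrix (Fin N) (Fin N) ℂ)ˣ) : Matrix (Fin N) (Fin N) ℂ) ∈ unitary (Matrix (Fin N) (Fin N) ℂ))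
    (p : PlaqY i) (A B : FBondY i → Matrix (Fin N) (Fin N) ℂ) (l m : Fin 4) :
    tau i U p B A l m = -star (tau i U p A B m l) := by
  unfold tau
  rw [← Matrix.trace_conjTranspose, Matrix.conjTranspose_mul, Matrix.conjTranspose_conjTranspose,
    trace_conjTranspose_commY_mul (conjTranspose_weight i U hU p)]
  rw [neg_neg]

/-- the transporters of the primed variables are unitary at a unitary-valued configuration. [cite: Balaban1985BackgroundPropagators, (3.2) p.390, bookkeeping] -/
theorem edgeParY_mem_unitary (hU : ∀ μ x, ((U μ x : (Matrix (Fin N) (Fin N) ℂ)ˣ) : Matrix (Fin N) (Fin N) ℂ) ∈ unitary (Matrix (Fin N) (Fin N) ℂ))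
    (p : PlaqY i) (m : Fin 4) : ((edgeParY i U p m : (Matrix (Fin N) (Fin N) ℂ)ˣ) : Matrix (Fin N) (Fin N) ℂ) ∈ unitary (Matrix (Fin N) (Fin N) ℂ) := by
  unfold edgeParY
  fin_cases m
  · exact hU _ _
  · show (((1 : (Matrix (Fin N) (Fin N) ℂ)ˣ)) : Matrix (Fin N) (Fin N) ℂ) ∈ _; rw [Units.val_one]; exact (unitary _).one_mem
  · show (((1 : (Matrix (Fin N) (Fin N) ℂ)ˣ)) : Matrix (Fin N) (Fin N) ℂ) ∈ _; rw [Units.val_one]; exact (unitary _).one_mem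
  · exact hU _ _

/-- one `(p, m)` term of the pairing: `tr((σ_m R(V_m⁻¹) i[S_m(A), M_p])\* · B(b_m)) = −Σ_l ε(l, m)·τ_p(A, B; l, m)`. [cite: Balaban1985BackgroundPropagators, (3.10) p.392, bookkeeping] -/
theorem curv2Y_term (hU : ∀ μ x, ((U μ x : (Matrix (Fin N) (Fin N) ℂ)ˣ) : Matrix (Fin N) (Fin N) ℂ) ∈ unitary (Matrix (Fin N) (Fin N) ℂ))
    (p : PlaqY i) (m : Fin 4) (A B : FBondY i → Matrix (Fin N) (Fin N) ℂ) :
    Matrix.trace ((sgnY m • B9Eq39Adjoint.R (edgeParY i U p m)⁻¹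
        (commY ((((i.cf ^ 2 : ℝ)) : ℂ) • imHolY i U p) (contourSum i U p m A)))ᴴ * B (edgeY i p m)) =
      -∑ l : Fin 4, eps l m * tau i U p A B l m := by
  have hV := edgeParY_mem_unitary i U hU p m
  have hVi : (((edgeParY i U p m)⁻¹ : (Matrix (Fin N) (Fin N) ℂ)ˣ) : Matrix (Fin N) (Fin N) ℂ) ∈ unitary (Matrix (Fin N) (Fin N) ℂ) :=
    (B7Prop2Explicit.unitaryUnits (Matrix (Fin N) (Fin N) ℂ)).inv_mem hV
  rw [Matrix.conjTranspose_smul, star_sgnY, Matrix.smul_mul, Matrix.trace_smul, smul_eq_mul, trace_conjTranspose_R_mul _ hVi, inv_inv,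
    trace_conjTranspose_commY_mul (conjTranspose_weight i U hU p), mul_neg]
  have e2 : sgnY m * Matrix.trace ((contourSum i U p m A)ᴴ *
      commY ((((i.cf ^ 2 : ℝ)) : ℂ) • imHolY i U p) (B9Eq39Adjoint.R (edgeParY i U p m) (B (edgeY i p m)))) =
      Matrix.trace ((contourSum i U p m A)ᴴ * commY ((((i.cf ^ 2 : ℝ)) : ℂ) • imHolY i U p) (primeEdgeY i U p m B)) := by
    rw [primeEdgeY_apply, map_smul, Matrix.mul_smul, Matrix.trace_smul, smul_eq_mul]
  rw [e2, contourSum_apply, Matrix.conjTranspose_sum, Finset.sum_mul, Matrix.trace_sum]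
  congr 1
  refine Finset.sum_congr rfl fun l _ => ?_
  rw [Matrix.conjTranspose_smul, star_eps, Matrix.smul_mul, Matrix.trace_smul, smul_eq_mul]
  rfl

/-- ★ **THE TRACE PAIRING OF `Δ′₂(U)A` WITH `B`** as the antisymmetrically signed double contour sum
`Σ_b tr((Δ′₂A)(b)\* B(b)) = −½ Σ_p Σ_m Σ_l ε(l, m)·τ_p(A, B; l, m)`. [cite: Balaban1985BackgroundPropagators, (3.10) p.392] -/
theorem sum_trace_curv2Y (hU : ∀ μ x, ((U μ x : (Matrix (Fin N) (Fin N) ℂ)ˣ) : Matrix (Fin N) (Fin N) ℂ) ∈ unitary (Matrix (Fin N) (Fin N) ℂ))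
    (A B : FBondY i → Matrix (Fin N) (Fin N) ℂ) :
    ∑ b, Matrix.trace ((curv2Y i U A b)ᴴ * B b) = -(1 / 2 : ℂ) * ∑ p : PlaqY i, ∑ m : Fin 4, ∑ l : Fin 4, eps l m * tau i U p A B l m := by
  classical
  have h1 : ∀ b, Matrix.trace ((curv2Y i U A b)ᴴ * B b) = (1 / 2 : ℂ) * ∑ p : PlaqY i, ∑ m : Fin 4,
      if edgeY i p m = b then Matrix.trace ((sgnY m • B9Eq39Adjoint.R (edgeParY i U p m)⁻¹
        (commY ((((i.cf ^ 2 : ℝ)) : ℂ) • imHolY i U p) (contourSum i U p m A)))ᴴ * B b) else 0 := by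
    intro b
    rw [curv2Y_apply, Matrix.conjTranspose_smul, Matrix.smul_mul, Matrix.trace_smul, smul_eq_mul]
    congr 1
    · rw [Complex.star_def, map_div₀, map_one, map_ofNat]
    · rw [Matrix.conjTranspose_sum, Finset.sum_mul, Matrix.trace_sum]
      refine Finset.sum_congr rfl fun p _ => ?_
      rw [Matrix.conjTranspose_sum, Finset.sum_mul, Matrix.trace_sum]
      refine Finset.sum_congr rfl fun m _ => ?_
      split_ifs
      · rfl
      · rw [Matrix.conjTranspose_zero, Matrix.zero_mul, Matrix.trace_zero]
  simp_rw [h1]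
  rw [← Finset.mul_sum, neg_mul, ← mul_neg, ← Finset.sum_neg_distrib]
  congr 1
  rw [Finset.sum_comm]
  refine Finset.sum_congr rfl fun p _ => ?_
  rw [Finset.sum_comm, ← Finset.sum_neg_distrib]
  refine Finset.sum_congr rfl fun m _ => ?_
  rw [Finset.sum_ite_eq, if_pos (Finset.mem_univ _), curv2Y_term i U hU p m A B]

/-- ★★ **THE COMMUTATOR PART `Δ′₂(U)` OF THE HESSIAN (3.10) IS SYMMETRIC** for the trace pairing at every unitary-valued configuration.
[cite: Balaban1985BackgroundPropagators, (3.10) p.392 («it is a hermitian operator»)] -/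
theorem curv2Y_isSymmTr (hU : ∀ μ x, ((U μ x : (Matrix (Fin N) (Fin N) ℂ)ˣ) : Matrix (Fin N) (Fin N) ℂ) ∈ unitary (Matrix (Fin N) (Fin N) ℂ)) :
    IsSymmTr (fun _ => (1 : ℝ)) (curv2Y i U) := by
  intro A B
  rw [trIP_comm (fun _ => (1 : ℝ)) A, trIP_one_eq, trIP_one_eq, sum_trace_curv2Y i U hU A B, sum_trace_curv2Y i U hU B A]
  have hY : ∑ p : PlaqY i, ∑ m : Fin 4, ∑ l : Fin 4, eps l m * tau i U p B A l m =
      star (∑ p : PlaqY i, ∑ m : Fin 4, ∑ l : Fin 4, eps l m * tau i U p A B l m) := by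
    simp_rw [star_sum, star_mul', star_eps]
    refine Finset.sum_congr rfl fun p _ => ?_
    rw [Finset.sum_comm]
    refine Finset.sum_congr rfl fun a _ => Finset.sum_congr rfl fun b _ => ?_
    rw [tau_swap i U hU p A B a b, eps_swap b a]
    ring
  rw [hY, show -(1 / 2 : ℂ) * star (∑ p : PlaqY i, ∑ m : Fin 4, ∑ l : Fin 4, eps l m * tau i U p A B l m) =
      star (-(1 / 2 : ℂ) * ∑ p : PlaqY i, ∑ m : Fin 4, ∑ l : Fin 4, eps l m * tau i U p A B l m) by
    rw [star_mul', star_neg, Complex.star_def, map_div₀, map_one, map_ofNat]]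
  exact (Complex.conj_re _).symm

end Pairing

/-! ## §3 Consequently: `Δ_a(U)` and `G(U) = Δ_a(U)⁻¹` ARE symmetric at `G`-valued data (the row-17 clause `symmG`, discharged modulo invertibilities) -/

section Consequences

open scoped Matrix.Norms.L2Operator

variable {d ℓ : ℕ} {hd : 1 ≤ d + 1} {hL : Odd (ℓ + 1) ∧ 1 < ℓ + 1} {b₀ b₁ : ℝ} {N : ℕ}
variable (i : KIdx d ℓ hd hL b₀ b₁)

/-- ★★ **def-Y's `Δ_a(U)` (3.26) IS SYMMETRIC** for the trace pairing at `G`-valued data (`G ≤ U(N)`), given a symmetric Δ′_a(U) and Q′\*(U) the `W`-adjoint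
of Q′(U) — `B9Thm311AdjointPairs.deltaAY_isSymmTr_of` with its `curv2Y` input DISCHARGED by `curv2Y_isSymmTr`.
[cite: Balaban1985BackgroundPropagators, (3.26) p.395, (3.10) p.392, Thm 3.11 p.416] -/
theorem deltaAY_isSymmTr {G : Subgroup (Matrix (Fin N) (Fin N) ℂ)ˣ} (hG : G ≤ B7Prop2Explicit.unitaryUnits (Matrix (Fin N) (Fin N) ℂ))
    (parS : SiteParY (Matrix (Fin N) (Fin N) ℂ) i) (parB : BondParY (Matrix (Fin N) (Fin N) ℂ) i) (U : CfgY (Matrix (Fin N) (Fin N) ℂ) i)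
    (hU : ∀ μ x, U μ x ∈ G) (hparB : ∀ s s', parB U s s' ∈ G) (hΔ' : IsSymmTr (fun _ => (1 : ℝ)) (deltaPrimeAY i parS U))
    (hadj : IsAdjTr (fun _ => (1 : ℝ)) (B9Thm311ReadingAtLetters.wB i) (QpY i parS U) (QpsY i parS U)) :
    IsSymmTr (fun _ => (1 : ℝ)) (deltaAY i parS parB (GpY i parS) U) :=
  deltaAY_isSymmTr_of i hG parS parB U hU hparB hΔ' hadj (curv2Y_isSymmTr i U fun μ x => hG (hU μ x))

/-- ★★ **def-Y's `G(U) = Ring.inverse Δ_a(U)` IS SYMMETRIC** (print p.416: *"It is a symmetric and invertible operator"*) at `G`-valued data, given in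
addition the invertibility of Δ_a(U) (Thm 3.3) — the row-17 clause `symmG` at letters with `Gp := GpY`, `GA := GAY`, REDUCED to invertibilities and the
symmetry of Δ′_a(U) (a theorem at def-Y's v4 letters). [cite: Balaban1985BackgroundPropagators, (3.27) p.395, Thm 3.11 p.416] -/
theorem GAY_isSymmTr {G : Subgroup (Matrix (Fin N) (Fin N) ℂ)ˣ} (hG : G ≤ B7Prop2Explicit.unitaryUnits (Matrix (Fin N) (Fin N) ℂ))
    (parS : SiteParY (Matrix (Fin N) (Fin N) ℂ) i) (parB : BondParY (Matrix (Fin N) (Fin N) ℂ) i) (U : CfgY (Matrix (Fin N) (Fin N) ℂ) i)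
    (hU : ∀ μ x, U μ x ∈ G) (hparB : ∀ s s', parB U s s' ∈ G) (hΔ' : IsSymmTr (fun _ => (1 : ℝ)) (deltaPrimeAY i parS U))
    (hadj : IsAdjTr (fun _ => (1 : ℝ)) (B9Thm311ReadingAtLetters.wB i) (QpY i parS U) (QpsY i parS U)) :
    IsSymmTr (fun _ => (1 : ℝ)) (GAY i parS parB (GpY i parS) U) :=
  isSymmTr_ringInverse _ (deltaAY_isSymmTr i hG parS parB U hU hparB hΔ' hadj)

end Consequences

end

end Literature.MathematicalPhysics.QuantumFieldTheory.Balaban1983to89.B9Thm311Curv2Symm
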